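/-
Copyright (c) 2026. All rights reserved.
Released under Apache 2.0 license as described in the file LICENSE.
Authors: abc-iut cell, statement-typer seat abc-iut-L4-t3 (wave 1; gen 9), owner of the §5 interface — the
print-faithful `⋉`-successor of the FROZEN `LogFrobeniusCompatibility.lean` (gens 0–2), L4-lead ruling m162.
-/
import Mathlib.CategoryTheory.Equivalence
import Literature.AnabelianGeometry.AbsoluteAnabelian.LogFrobeniusCompatibility
import Literature.AnabelianGeometry.AbsoluteAnabelian.LogFrobeniusObservables
import HarnessLib

/-!
# [AbsTopIII] Def 5.4 (vii) / Cor 5.5 (iii): the `⋉`-SUCCESSOR of the §5 interface — `ι⊞_{v,ε}` on the edges of `Γ⃗^⋉_v` at EVERY place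

S. Mochizuki, *Topics in absolute anabelian geometry III: global reconstruction algorithms*, J. Math. Sci. Univ.
Tokyo 22 (2015) 939–1156 [MochizukiAbsTopIII2015]; locators `p.N` = pages of the author's manuscript
(`paper:url-5493eb38cbb7`), read on the page (own render): Def 5.4 (iii) p. 126 l. 54–58 and (v) p. 127 l. 60–64
("Observe that the entire diagram `Γ⃗^log` may be considered as a diagram in the category `TS` [`TH`], whereas the
diagram `Γ⃗^⋉` [= `Γ⃗^log` minus the arrow `↪ k` into the space-link vertex] may be considered either as a diagram in
`TS` [`TH`] or as a diagram in `TS⊞` [`TH⊞`]"), Def 5.4 (vii) p. 128 l. 45–55 ("For each edge `ε` of `Γ⃗^⋉_v`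
(respectively, `Γ⃗^log_v`) running from a vertex `ν₁` to a vertex `ν₂`, the arrow … determines a natural transformation
`ι⊞_{v,ε} : λ⊞_{v,ν₁} ∘ Λ_{ν₁} → λ⊞_{v,ν₂}` (respectively, `ι_{v,ε} : λ_{v,ν₁} ∘ Λ_{ν₁} → λ_{v,ν₂}`)"), Cor 5.5 (iii) p. 131
l. 22–26 ("`ι⊞_{v,ε}` (respectively, `ι_{v,ε}`) — where `v ∈ 𝕍(F_mod)`; `ε` is an edge of `Γ⃗^⋉_v` (respectively, `Γ⃗^log_v`)").

## Why a successor (cell typing finding T3g9-F1 of record, L4-lead m162; print UNCHANGED)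

The frozen interface `AbsoluteAnabelian.LogFrobeniusSetting` (`LogFrobeniusCompatibility.lean`) types the `⊞`-valued
homotopies over `AbsoluteAnabelian.LogEdge`, whose archimedean clause is `LogEdge true := ArchEdge` — ALL three arrows of
`Γ⃗^log_arc`, under the single-"respectively" reading of Def 5.4 (vii) (its docstring: "all edges of `Γ⃗^log_v` for `v`
archimedean").  Cor 5.5 (iii) p. 131 l. 22–26 fixes the reading uniformly in `v`: `ι⊞` lives on `Γ⃗^⋉_v` ONLY; the
space-link arrow `k^× ↪ k` carries only the `TS`/`TH`-valued `ι_{v,ε}` (typed apart, correctly, as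
`LogFrobeniusSetting.TSHomotopies` over `LogEdgeTS`).  The over-typed component is EMPTY at genuine archimedean data
(abc-iut-L4-t8 `HolTFPair.isEmpty_lamTimesPlus_hom_lamSimPlus`) and makes the `η⊢` add-on of Cor 5.10 (iv)(c) empty at every
carrier with print's archimedean shapes (this seat's `LogFrobeniusArchPlusNoGo.lean`).  DEFS-freeze forbids an in-place
amendment (36/59 consumer files), so the repair is THIS successor, differing from the frozen file in EXACTLY ONE CLAUSE:

* `LogEdgeLtimes` — `| true, ν₁, ν₂ => {e : ArchEdge ν₁ ν₂ // e.InLeft}` (was `ArchEdge ν₁ ν₂`); the nonarchimedean clause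
  `{e : NonarchEdge ν₁ ν₂ // e.InLeft}` is unchanged.  `LogEdgeLtimes.toOld`, `LogEdgeLtimes.toTS`, `LogEdgeLtimes.ofTS` relate it to the frozen
  edge types;
* `LogFrobeniusSettingLtimes` — the forty fields of the frozen structure VERBATIM (docstrings included), `iota` now ranging
  over `LogEdgeLtimes`; in particular the proviso `lam_spaceLink_eq_postLog` and the single mono-analyticization
  `monoNplus v : 𝒩⊞_v ⥤ 𝒩⊢⊞_v` are UNCHANGED (a genuine archimedean carrier takes `𝒩⊞_v := 𝒞^hol_{TH⊞}`-pairs and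
  `monoNplus` reading the `TH⊞`-object via abc-iut-L4-t8's `HolTHPlusPair.toTBPlus`, Def 5.6 (iv) — the cell's row S3);
* `DVertex.categoryLtimes`, `DVertex.instCategoryVertexLtimes`, `DEdge.functorLtimes` — the frozen quiver `DVertex`/`DEdge` of `D•⊢`
  (REUSED: same vertices, same arrows) realised by the successor's data, verbatim;
* (sequel `Ltimes/LogFrobeniusRestrict.lean`) `LogFrobeniusSetting.toLtimes` — EVERY frozen-interface carrier restricts to
  a `⋉`-carrier (forget `ι⊞` along `k^× ↪ k`), with `rfl` field lemmas — the pattern by which theorems proved over the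
  successor specialise to the frozen interface ("old theorems become `toLtimes` corollaries", m162).

DESIGN (cell note): the successor's declarations carry the suffix `Ltimes` in the UNCHANGED namespace
`….AbsoluteAnabelian` (module directory `AbsoluteAnabelian/Ltimes/`); the Cor 5.10 (iv) theory files are re-elaborated over it
by copying them into the sub-directory under `namespace LogFrobeniusSettingLtimes` with a five-rule `sed` (recipe: cell staging
`L4/L4-t3/gen9/LTIMES-RECIPE.md`; the gate's restatement lint forbids same-name shadowing in a sub-namespace); everything
setting-independent (`LogVertex`, `NonarchEdge`, `ArchEdge`, `LogEdgeTS`, `frobeniusTwist`, `DVertex`, `DEdge`, `DVertex.shift`, the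
generic `Diagram*`/telecore/contact machinery) is REUSED, not copied.  The frozen interface, its Cor 5.5 / observables lanes and all landed carriers stay as they are.
Refereed pre-IUT material; a successor of OUR typing, print unchanged; nothing here bears on [IUTchIII] Cor. 3.12; no side
taken; typed ≠ proved.
-/

set_option autoImplicit false

universe u

open CategoryTheory

namespace Literature.AnabelianGeometry.AbsoluteAnabelian

/-! ## Def 5.4 (vii) / Cor 5.5 (iii): the edges carrying `ι⊞` — `Γ⃗^⋉_v` at every place -/

/-- the edges of `Γ⃗^log_v` along which Def 5.4 (vii) provides the `⊞`-valued `ι⊞_{v,ε}`: **the edges of `Γ⃗^⋉_v`, at EVERY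
place** — archimedean: `k~ →(id) k~` and the shell-arrow `k~ ↠ k^×`, NOT the space-link inclusion `k^× ↪ k` ("`Γ⃗^⋉_arc` … may
be considered … in `TH⊞`", Def 5.4 (v)); nonarchimedean: the five arrows other than `k̄^× ↪ k̄` (Def 5.4 (iii)).  Cor 5.5 (iii)
p. 131: "`ι⊞_{v,ε}` … where `v ∈ 𝕍(F_mod)`; `ε` is an edge of `Γ⃗^⋉_v`".  (The frozen `LogEdge` takes ALL archimedean arrows —
typing finding T3g9-F1.) [cite: MochizukiAbsTopIII2015, Def 5.4 (vii) p. 128] -/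
def LogEdgeLtimes : (b : Bool) → LogVertex b → LogVertex b → Type
  | true, ν₁, ν₂ => {e : ArchEdge ν₁ ν₂ // e.InLeft}
  | false, ν₁, ν₂ => {e : NonarchEdge ν₁ ν₂ // e.InLeft}

namespace LogEdgeLtimes

/-- an edge of `Γ⃗^⋉_v` is an edge of the frozen interface's index type (identity at a nonarchimedean place, the
inclusion `Γ⃗^⋉_arc ⊂ Γ⃗^log_arc` at an archimedean one). [cite: MochizukiAbsTopIII2015, Def 5.4 (vii) p. 128] -/
def toOld : {b : Bool} → {ν₁ ν₂ : LogVertex b} → LogEdgeLtimes b ν₁ ν₂ → AbsoluteAnabelian.LogEdge b ν₁ ν₂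
  | true, _, _, ε => ε.1
  | false, _, _, ε => ε

/-- an edge of `Γ⃗^⋉_v` is an edge of `Γ⃗^log_v` (`LogEdgeTS`, the index type of the `TS`/`TH`-valued `ι_{v,ε}`).
[cite: MochizukiAbsTopIII2015, Def 5.4 (vii) p. 128] -/
def toTS : {b : Bool} → {ν₁ ν₂ : LogVertex b} → LogEdgeLtimes b ν₁ ν₂ → LogEdgeTS b ν₁ ν₂
  | true, _, _, ε => ε.1
  | false, _, _, ε => ε.1

/-- `toTS` factors through the frozen index type. [cite: MochizukiAbsTopIII2015, Def 5.4 (vii) p. 128] -/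
theorem toOld_toTS {b : Bool} {ν₁ ν₂ : LogVertex b} (ε : LogEdgeLtimes b ν₁ ν₂) : ε.toOld.toTS = ε.toTS := by
  cases b <;> rfl

/-- membership of an edge of `Γ⃗^log_v` in `Γ⃗^⋉_v`, uniformly in the kind of place.
[cite: MochizukiAbsTopIII2015, Def 5.4 (iii) p. 126] -/
def _root_.Literature.AnabelianGeometry.AbsoluteAnabelian.LogEdgeTS.InLeft :
    {b : Bool} → {ν₁ ν₂ : LogVertex b} → LogEdgeTS b ν₁ ν₂ → Prop
  | true, _, _, e => ArchEdge.InLeft e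
  | false, _, _, e => NonarchEdge.InLeft e

/-- an edge of `Γ⃗^log_v` lying in `Γ⃗^⋉_v` as an edge of `Γ⃗^⋉_v`. [cite: MochizukiAbsTopIII2015, Def 5.4 (vii) p. 128] -/
def ofTS : {b : Bool} → {ν₁ ν₂ : LogVertex b} → (e : LogEdgeTS b ν₁ ν₂) → e.InLeft → LogEdgeLtimes b ν₁ ν₂
  | true, _, _, e, h => ⟨e, h⟩
  | false, _, _, e, h => ⟨e, h⟩

/-- `ofTS` then `toTS` is the identity. [cite: MochizukiAbsTopIII2015, Def 5.4 (vii) p. 128] -/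
@[simp] theorem toTS_ofTS {b : Bool} {ν₁ ν₂ : LogVertex b} (e : LogEdgeTS b ν₁ ν₂) (h : e.InLeft) :
    (ofTS e h).toTS = e := by
  cases b <;> rfl

/-- every edge of `Γ⃗^⋉_v` lies in `Γ⃗^⋉_v`. [cite: MochizukiAbsTopIII2015, Def 5.4 (iii) p. 126] -/
theorem inLeft_toTS {b : Bool} {ν₁ ν₂ : LogVertex b} (ε : LogEdgeLtimes b ν₁ ν₂) : ε.toTS.InLeft := by
  cases b
  · exact ε.2
  · exact ε.2

/-- **there is NO `⊞`-edge into the space-link vertex**, at any place (the arrow `↪ k` is removed from `Γ⃗^⋉_v`).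
[cite: MochizukiAbsTopIII2015, Def 5.4 (iii) p. 126] -/
theorem isEmpty_toSpaceLink (b : Bool) (ν : LogVertex b) : IsEmpty (LogEdgeLtimes b ν (LogVertex.spaceLink b)) := by
  cases b
  · exact ⟨fun ε => by obtain ⟨e, he⟩ := ε; cases e; exact he⟩
  · exact ⟨fun ε => by obtain ⟨e, he⟩ := ε; cases e; exact he⟩

end LogEdgeLtimes

/-! ## The successor interface: Def 5.4 (ii), (iv), (vi), (vii); Cor 5.2; Def 5.6 (iii), (iv); Prop 5.8 (vii) -/

/-- **`⋉`-SUCCESSOR INTERFACE** (the frozen `AbsoluteAnabelian.LogFrobeniusSetting` with `ι⊞` indexed by `Γ⃗^⋉_v` at every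
place, Cor 5.5 (iii) p. 131; every other field VERBATIM).  For fixed `Z` (elliptically admissible hyperbolic orbicurve over
`ℚ̄`), `T ∈ {TF, TM}`, `• ∈ {⊚, ✠}`, index set `V(F_mod)` with its archimedean/nonarchimedean partition (`isArc`): the
categories and functors of the global log-Frobenius picture. Fields quote print:
* `X` = `𝒳 := Th•_T[Z]`, `E` = `ℰ• := Th•[Z]`, `proj : 𝒳 → ℰ•` (Def 5.4 (i));
* `log` = "the global/panalocal log-Frobenius functor `log•_{T,T} : Th•_T → Th•_T`, which is naturally isomorphic
  to the identity functor, hence an equivalence of categories", "lies over `Th•`" (Def 5.4 (ii));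
* `Nplus v`, `N v`, `forget v : 𝒩⊞_v → 𝒩_v`, `toE v : 𝒩_v → ℰ•`, and `lam v ν = λ⊞_{v,ν} : Th•_T[Z] → 𝒩⊞_v` for each
  vertex `ν` of `Γ⃗^log_v`, the space-link and post-log functors being identified (Def 5.4 (iv), (vi));
* `iota v ε = ι⊞_{v,ε} : λ⊞_{v,ν₁} ∘ Λ_{ν₁} → λ⊞_{v,ν₂}` for the edges `ε` of `Γ⃗^⋉_v` (Def 5.4 (vii), Cor 5.5 (iii));
* `An`, `κAn : ℰ• ≌ An•[𝒳]`, `φAn : An•[𝒳] → 𝒳` (an equivalence, the forgetful functor of Cor 5.2 (iv), (vii)),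
  `πAn := proj ⋙ κAn`, `ηAn : φAn ∘ πAn ≅ id_𝒳` (Cor 5.5 preamble);
* mono-analytic side: `Emono` = `ℰ⊢ := Th⊢[Z]`, `monoAn : ℰ• → ℰ⊢` (Def 5.6 (ii)), `NmonoPlus w`, `Nmono w`,
  `forgetMono`, `toEmono` (Def 5.6 (iii), (iv)), `monoN`, `monoNplus` (the vertical mono-analyticization functors
  of the 1-commutative diagrams of Def 5.6 (iii), (iv)), `AnMono` = `An⊢[𝒩⊢⊞] := ∏_v An⊢[𝒩⊢⊞_v]` with the
  equivalence `ℰ⊢ ≌ An⊢[𝒩⊢⊞]` and forgetful functors `ψ^{An⊢⊞}_{w,ν}` (Prop 5.8 (vii)).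
[cite: MochizukiAbsTopIII2015, Def 5.4 (ii) p. 125] -/
structure LogFrobeniusSettingLtimes (Vmod : Type u) (isArc : Vmod → Bool) : Type (u + 2) where
  /-- `𝒳 := Th•_T[Z]` -/
  X : Type (u + 1)
  /-- category structure -/
  [catX : Category.{u} X]
  /-- `ℰ• := Th•[Z]` -/
  E : Type (u + 1)
  /-- category structure -/
  [catE : Category.{u} E]
  /-- the natural projection `Th•_T[Z] → Th•[Z]` -/
  proj : X ⥤ E
  /-- the log-Frobenius functor `log•_{T,T}` -/
  log : X ⥤ X
  /-- "naturally isomorphic to the identity functor" -/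
  logIsoId : log ≅ 𝟭 X
  /-- "lies over `Th•`": the underlying Galois-theater is unchanged -/
  logOver : log ⋙ proj ≅ proj
  /-- `𝒩⊞_v` -/
  Nplus : Vmod → Type (u + 1)
  /-- category structure -/
  [catNplus : ∀ v, Category.{u} (Nplus v)]
  /-- `𝒩_v` -/
  N : Vmod → Type (u + 1)
  /-- category structure -/
  [catN : ∀ v, Category.{u} (N v)]
  /-- `𝒩⊞_v → 𝒩_v` -/
  forget : ∀ v, Nplus v ⥤ N v
  /-- `𝒩_v → Th•[Z]` -/
  toE : ∀ v, N v ⥤ E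
  /-- `λ⊞_{v,ν} : Th•_T[Z] → 𝒩⊞_v`, `ν` a vertex of `Γ⃗^log_v` -/
  lam : ∀ v, LogVertex (isArc v) → (X ⥤ Nplus v)
  /-- `λ⊞_{v,ν}` "lies over `Th•[Z]`" -/
  lamOver : ∀ v ν, lam v ν ⋙ forget v ⋙ toE v ≅ proj
  /-- "subject to the proviso that we identify the functors associated to the space-link and post-log vertices"
  (Cor 5.5 p. 130; both assign the underlying additive group of the field, Def 5.4 (iv), (vi)) -/
  lam_spaceLink_eq_postLog : ∀ v, lam v (LogVertex.spaceLink (isArc v)) = lam v (LogVertex.postLog (isArc v))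
  /-- `ι⊞_{v,ε} : λ⊞_{v,ν₁} ∘ Λ_{ν₁} → λ⊞_{v,ν₂}` for the edges `ε : ν₁ → ν₂` of `Γ⃗^⋉_v` (Def 5.4 (vii), Cor 5.5 (iii)) -/
  iota : ∀ v {ν₁ ν₂ : LogVertex (isArc v)}, LogEdgeLtimes (isArc v) ν₁ ν₂ →
    (frobeniusTwist log ν₁.isPostLog ⋙ lam v ν₁ ⟶ lam v ν₂)
  /-- `An•[𝒳]` -/
  An : Type (u + 1)
  /-- category structure -/
  [catAn : Category.{u} An]
  /-- `κ_{An•} : ℰ• ≃ An•[𝒳]` (Cor 5.2 (i), (iv), (vii), restricted to `[Z]`) -/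
  κAn : E ≌ An
  /-- the forgetful functor `φ_{An•} : An•[𝒳] → 𝒳`, an equivalence -/
  φAn : An ⥤ X
  /-- `φ_{An•}` is an equivalence -/
  φAn_isEquivalence : φAn.IsEquivalence
  /-- `η_{An•} : φ_{An•} ∘ π_{An•} ≅ id_𝒳` with `π_{An•} := proj ⋙ κ_{An•}` -/
  ηAn : (proj ⋙ κAn.functor) ⋙ φAn ≅ 𝟭 X
  /-- the second natural equivalence `An•[𝒳] ≃ ℰ•` of "the natural equivalences `ℰ• ≃ An•[𝒳] ≃ ℰ•`" (rows 6 → 7);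
  recorded as an independent datum (the print does not relate it to `κ_{An•}`; interface) -/
  κAn₂ : An ≌ E
  /-- `ℰ⊢ := Th⊢[Z]` -/
  Emono : Type (u + 1)
  /-- category structure -/
  [catEmono : Category.{u} Emono]
  /-- the mono-analyticization `Th•[Z] → Th⊢[Z]` -/
  monoAn : E ⥤ Emono
  /-- `𝒩⊢⊞_w` -/
  NmonoPlus : Vmod → Type (u + 1)
  /-- category structure -/
  [catNmonoPlus : ∀ w, Category.{u} (NmonoPlus w)]
  /-- `𝒩⊢_w` -/
  Nmono : Vmod → Type (u + 1)
  /-- category structure -/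
  [catNmono : ∀ w, Category.{u} (Nmono w)]
  /-- `𝒩⊢⊞_w → 𝒩⊢_w` -/
  forgetMono : ∀ w, NmonoPlus w ⥤ Nmono w
  /-- `𝒩⊢_w → Th⊢[Z]` -/
  toEmono : ∀ w, Nmono w ⥤ Emono
  /-- mono-analyticization `𝒩⊞_v → 𝒩⊢⊞_v` -/
  monoNplus : ∀ v, Nplus v ⥤ NmonoPlus v
  /-- mono-analyticization `𝒩_v → 𝒩⊢_v` -/
  monoN : ∀ v, N v ⥤ Nmono v
  /-- the mono-analyticization homotopy `𝒩⊞_v → 𝒩⊢⊞_v → 𝒩⊢_v ≅ 𝒩⊞_v → 𝒩_v → 𝒩⊢_v` -/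
  monoHomotopy : ∀ v, monoNplus v ⋙ forgetMono v ≅ forget v ⋙ monoN v
  /-- `An⊢[𝒩⊢⊞] := ∏_v An⊢[𝒩⊢⊞_v]` (fibred product over `ℰ⊢`) -/
  AnMono : Type (u + 1)
  /-- category structure -/
  [catAnMono : Category.{u} AnMono]
  /-- the equivalence `Th⊢[Z] ≃ An⊢[𝒩⊢⊞]` of Prop 5.8 (vii) -/
  κAnMono : Emono ≌ AnMono
  /-- the forgetful functors `ψ^{An⊢⊞}_{w,ν} : An⊢[𝒩⊢⊞] → 𝒩⊢⊞_w` (restricted as `φ^{An⊢⊞}_{w,ν}`), "for each vertex `ν`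
  of `Γ⃗^×_w`" (there is no field structure at the space-link / post-log vertices on the mono-analytic side) -/
  ψAnMono : ∀ w, {ν : LogVertex (isArc w) // ν.IsCross} → (AnMono ⥤ NmonoPlus w)

namespace LogFrobeniusSettingLtimes

variable {Vmod : Type u} {isArc : Vmod → Bool} (L : LogFrobeniusSettingLtimes Vmod isArc)

/-- `𝒳` is a category (the structure's instance field, exposed). [cite: MochizukiAbsTopIII2015, Def 5.4 (i) p. 125] -/
instance instCategoryX : Category.{u} L.X := L.catX
/-- `ℰ•` is a category. [cite: MochizukiAbsTopIII2015, Def 5.4 (i) p. 125] -/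
instance instCategoryE : Category.{u} L.E := L.catE
/-- `𝒩⊞_v` is a category. [cite: MochizukiAbsTopIII2015, Def 5.4 (iv) p. 127] -/
instance instCategoryNplus (v : Vmod) : Category.{u} (L.Nplus v) := L.catNplus v
/-- `𝒩_v` is a category. [cite: MochizukiAbsTopIII2015, Def 5.4 (iv) p. 127] -/
instance instCategoryN (v : Vmod) : Category.{u} (L.N v) := L.catN v
/-- `An•[𝒳]` is a category. [cite: MochizukiAbsTopIII2015, Cor 5.5 p. 130] -/
instance instCategoryAn : Category.{u} L.An := L.catAn
/-- `ℰ⊢` is a category. [cite: MochizukiAbsTopIII2015, Def 5.6 (ii) p. 135] -/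
instance instCategoryEmono : Category.{u} L.Emono := L.catEmono
/-- `𝒩⊢⊞_w` is a category. [cite: MochizukiAbsTopIII2015, Def 5.6 (iii) p. 136] -/
instance instCategoryNmonoPlus (w : Vmod) : Category.{u} (L.NmonoPlus w) := L.catNmonoPlus w
/-- `𝒩⊢_w` is a category. [cite: MochizukiAbsTopIII2015, Def 5.6 (iii) p. 136] -/
instance instCategoryNmono (w : Vmod) : Category.{u} (L.Nmono w) := L.catNmono w
/-- `An⊢[𝒩⊢⊞]` is a category. [cite: MochizukiAbsTopIII2015, Prop 5.8 (vii) p. 141] -/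
instance instCategoryAnMono : Category.{u} L.AnMono := L.catAnMono

/-- `log•_{T,T}` is an equivalence of categories. [cite: MochizukiAbsTopIII2015, Def 5.4 (ii) p. 125] -/
theorem log_isEquivalence : L.log.IsEquivalence :=
  Functor.isEquivalence_of_iso L.logIsoId.symm

/-- the `TS`/`TH`-valued homotopy datum along an edge of `Γ⃗^⋉_v`: `ι⊞_{v,ε}` composed with `𝒩⊞_v → 𝒩_v` ("the latter
functor is obtained by composing the former functor with the natural functor `𝒩⊞_v → 𝒩_v`", Def 5.4 (iv), (vi)).
[cite: MochizukiAbsTopIII2015, Def 5.4 (vii) p. 128] -/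
def iotaN (v : Vmod) {ν₁ ν₂ : LogVertex (isArc v)} (ε : LogEdgeLtimes (isArc v) ν₁ ν₂) :
    (frobeniusTwist L.log ν₁.isPostLog ⋙ L.lam v ν₁) ⋙ L.forget v ⟶ L.lam v ν₂ ⋙ L.forget v :=
  Functor.whiskerRight (L.iota v ε) (L.forget v)

end LogFrobeniusSettingLtimes

/-! ## The shape of `D•⊢` over the successor (Cor 5.5, Cor 5.10): same quiver, realised by the successor's data -/

namespace DVertex

variable {Vmod : Type u} {isArc : Vmod → Bool}

/-- the category realised at a vertex. [cite: MochizukiAbsTopIII2015, Cor 5.5 p. 129] -/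
def categoryLtimes (S : LogFrobeniusSettingLtimes Vmod isArc) : DVertex Vmod isArc → Type (u + 1)
  | .row1 _ => S.X | .core => S.X | .nplus v => S.Nplus v | .nv v => S.N v | .e5 => S.E | .an => S.An | .e7 => S.E
  | .nmonoPlus w => S.NmonoPlus w | .nmono w => S.Nmono w | .emono5 => S.Emono | .anMono => S.AnMono | .emono7 => S.Emono

/-- each vertex carries a category. [cite: MochizukiAbsTopIII2015, Cor 5.5 p. 129] -/
instance instCategoryVertexLtimes (S : LogFrobeniusSettingLtimes Vmod isArc) (x : DVertex Vmod isArc) :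
    Category.{u} (x.categoryLtimes S) := by
  cases x <;> dsimp only [categoryLtimes] <;> infer_instance

end DVertex

/-- the functor realised at an arrow of `D•⊢`. [cite: MochizukiAbsTopIII2015, Cor 5.5 p. 129] -/
def DEdge.functorLtimes {Vmod : Type u} {isArc : Vmod → Bool} (S : LogFrobeniusSettingLtimes Vmod isArc) :
    {a b : DVertex Vmod isArc} → DEdge isArc a b → (a.categoryLtimes S ⥤ b.categoryLtimes S)
  | _, _, .log _ => S.log
  | _, _, .toCore _ => 𝟭 S.X
  | _, _, .lam v ν _ => S.lam v ν
  | _, _, .forget v => S.forget v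
  | _, _, .toE v => S.toE v
  | _, _, .κAn => S.κAn.functor
  | _, _, .anToE => S.κAn₂.functor
  | _, _, .monoNplus v => S.monoNplus v
  | _, _, .monoN v => S.monoN v
  | _, _, .monoE5 => S.monoAn
  | _, _, .monoAn => S.κAn.inverse ⋙ S.monoAn ⋙ S.κAnMono.functor
  | _, _, .monoE7 => S.monoAn
  | _, _, .forgetMono w => S.forgetMono w
  | _, _, .toEmono w => S.toEmono w
  | _, _, .κAnMono => S.κAnMono.functor
  | _, _, .anMonoToE => S.κAnMono.inverse

end Literature.AnabelianGeometry.AbsoluteAnabelian
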